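import Literature.Analysis.ValidatedNumerics.ParametricLyapunovAffineCertificate
import Literature.Analysis.ValidatedNumerics.RExprMeanValueForm
import HarnessLib

/-!
# Piecewise-affine Lyapunov certificates for matrix families with `RExpr` entries
# (NON-AFFINE parameter dependence: per-leaf mean-value models with certified remainder)

Topic `Literature/Analysis/ValidatedNumerics`. `ParametricLyapunovAffineCertificate.lean` certifies a
uniform decay rate `Re μ ≤ −r` for the eigenvalues of an AFFINE real family
`J(x) = J₀ + Σ_k x_k J^{(k)}` on a box and — in its interval-`J` form `lyapAffLeafOKI` — for every
real matrix `J′` with `|J′ − J(x)| ≤ R` entrywise. Linearised power-system / network models are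
rarely affine in the physical parameters: a swing equation carries `K/(2H)` (damping or synchronising
coefficient over an uncertain inertia constant), rest-point Jacobians are rational in the set-points.
This file closes that gap for families whose entries are terms of the tree's language `RExpr` in the
rational operations, by gluing the kernel-checkable MEAN VALUE FORM of `RExprMeanValueForm.lean`
(per leaf: an affine model `A₀ + Σ_k x_k A^{(k)}` of the entry table with certified remainder radii
`R = O(w²)`) to the EXISTING interval-`J` leaf check:

* `rexprAffOK n K E B A₀ As R pq` — the kernel check that the leaf's affine model (ABSOLUTE
  coordinates) and radii enclose the `RExpr` table `E` on the leaf box `B` (entry check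
  `RExpr.affEntryOK` with centre value `A₀ᵢⱼ + Σ_k c_k A^{(k)}ᵢⱼ` and slopes `A^{(k)}ᵢⱼ`, enclosure
  precision `pq`); `rexprAffOK_sound`: `|E(x)ᵢⱼ − (A₀ + Σ_k x_k A^{(k)})ᵢⱼ| ≤ Rᵢⱼ` on the leaf;
* `LyapRexLeaf`, `lyapRexLeafOK n K E d s r` — a kd-leaf = model + radii + precision + an
  interval-`J` affine-Lyapunov leaf `LyapAffLeaf` for the balanced, shifted LOCAL family
  `(D A₀ D⁻¹ + s·1, D A^{(k)} D⁻¹)` with radii `D R D⁻¹`, checked by `lyapAffLeafOKI` verbatim;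
* `re_le_neg_of_lyapRexLeafOK` (per leaf) and **`re_le_neg_of_kdCheck_lyapRex`** (END-TO-END):
  positive scaling `d` and an accepted kd-tree ⇒ for EVERY `x` of the box, every complex eigenvalue
  `μ` of the real matrix `E(x)` (`rexprMatrix n E x`) satisfies `Re μ ≤ −(s + r)` — per leaf this is
  literally `re_le_neg_of_kdCheck_lyapAffI_conj_shifted` on the one-leaf tree with the member
  `J′ := E(x)`; `re_neg_of_kdCheck_lyapRex` (Hurwitz when `0 < s + r`).

What is NOT proved here: nothing for entries using `|·|, √, min, max`; no common-Lyapunov /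
time-varying statement (pointwise Hurwitz only, as in the affine file); first-order models only.
[GahinetApkarianChilali1996] §III and [Hladik2017] §3 / Thm. 7 (the leaves), [CarlsonSchneider1962] §1
(the spectral conclusion), [Moore1979] §4.4 eq. (4.19) / [Neumaier1991] Thm. 2.3.3 (the model) — all through the
imports. Everything here is proved; no named facts.
-/

noncomputable section

open Finset Matrix NonemptyInterval Set

namespace Literature.Analysis.ValidatedNumerics

/-! ### Matrix tables of `RExpr` entries: the affine model check on a leaf box -/

/-- **Model check for an `n × n` table of terms on the leaf box `B`**: every entry term `E i j` is
within `R i j` of the ABSOLUTE affine model `A₀ + Σ_{k<K} x_k A^{(k)}` on `B` (the entry check is run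
with the model's value at the centre `A₀ᵢⱼ + Σ_k c_k A^{(k)}ᵢⱼ` and the slopes `A^{(k)}ᵢⱼ`), at
enclosure precision `pq.1` with `pq.2` Heron steps. [cite: Moore1979, §4.4 eq. (4.19) (p. 43)] -/
def rexprAffOK (n K : ℕ) (E : List (List RExpr)) (B : Box) (A0 : List (List ℚ))
    (As : List (List (List ℚ))) (R : List (List ℚ)) (pq : ℕ × ℕ) : Bool :=
  rall n fun i ↦ rall n fun j ↦
    RExpr.affEntryOK K pq.1 pq.2 (eget E i j) B
      (mget A0 i j + rsum K fun k ↦ B.cen k * mget (As.getD k []) i j)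
      (fun k ↦ mget (As.getD k []) i j) (mget R i j)

/-- Entries of `finMat`. [folklore] -/
private theorem finMat_apply₇ (n : ℕ) (A : List (List ℚ)) (i j : Fin n) : finMat n A i j = mreal A i j := rfl

/-- **Soundness of the model check**: at every `x` of the leaf box the real matrix `E(x)` is a member
of the interval family `|J′ − (A₀ + Σ_k x_k A^{(k)})| ≤ R`.
[cite: Moore1979, §4.4 eq. (4.19) (p. 43); Neumaier1991, Thm. 2.3.3] -/
theorem rexprAffOK_sound {n K : ℕ} {E : List (List RExpr)} {B : Box} {A0 : List (List ℚ)}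
    {As : List (List (List ℚ))} {R : List (List ℚ)} {pq : ℕ × ℕ}
    (h : rexprAffOK n K E B A0 As R pq = true) (x : ℕ → ℝ) (hx : B.mem x) (i j : Fin n) :
    |rexprMatrix n E x i j - (finMat n A0
      + ParametricIntervalPosSemidef.paramMatrix (fun k : Fin K ↦ finMat n (As.getD k []))
          (fun k : Fin K ↦ x k)) i j| ≤ mreal R i j := by
  have hij := of_rall (of_rall h i.isLt) j.isLt
  have hb := RExpr.affEntryOK_sound hij hx
  have e1 : (((mget A0 i j + rsum K fun k ↦ B.cen k * mget (As.getD k []) i j : ℚ) : ℝ)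
        + ∑ k ∈ range K, ((mget (As.getD k []) i j : ℚ) : ℝ) * (x k - ((B.cen k : ℚ) : ℝ)))
      = (finMat n A0 + ParametricIntervalPosSemidef.paramMatrix
          (fun k : Fin K ↦ finMat n (As.getD k [])) (fun k : Fin K ↦ x k)) i j := by
    rw [Matrix.add_apply, ParametricIntervalPosSemidef.paramMatrix_apply, finMat_apply₇, rsum_eq_sum]
    push_cast
    simp only [Finset.sum_range, finMat_apply₇, mreal, add_assoc, ← Finset.sum_add_distrib]
    congr 1
    exact Finset.sum_congr rfl fun k _ ↦ by ring
  rw [← e1]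
  exact hb

/-! ### Leaves and the kd-tree certificate -/

/-- A kd-leaf for an `RExpr` family: the ABSOLUTE affine model `(A₀, A^{(k)})` of the entries on the
leaf box, the remainder radii `R`, the enclosure precision `(prec, Heron steps)`, and an interval-`J`
affine-Lyapunov leaf for the balanced, shifted local family.
[cite: GahinetApkarianChilali1996, §III; Moore1979, §4.4 eq. (4.19) (p. 43)] -/
structure LyapRexLeaf where
  /-- constant table of the affine model (absolute coordinates) -/
  A0 : List (List ℚ)
  /-- slope tables `A^{(k)}`, `k < K` -/
  As : List (List (List ℚ))
  /-- entrywise remainder radii `R ≥ |E(x) − (A₀ + Σ x_k A^{(k)})|` on the leaf -/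
  R : List (List ℚ)
  /-- enclosure precision and Heron steps for the kernel's interval evaluations -/
  pq : ℕ × ℕ
  /-- the interval-`J` affine-Lyapunov leaf data (`P_c, P^{(k)}, π`, three vertex bundles) -/
  inner : LyapAffLeaf
  deriving Inhabited

/-- **The leaf check**: the model encloses the table on the leaf box AND the interval-`J`
affine-Lyapunov check `lyapAffLeafOKI` accepts the balanced (`d`), shifted (`s`) local model with the
balanced radii and rate `r`. [cite: GahinetApkarianChilali1996, §III; Hladik2017, Thm. 7 and §3;
Moore1979, §4.4 eq. (4.19) (p. 43)] -/
def lyapRexLeafOK (n K : ℕ) (E : List (List RExpr)) (d : List ℚ) (s r : ℚ) (B : Box)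
    (l : LyapRexLeaf) : Bool :=
  rexprAffOK n K E B l.A0 l.As l.R l.pq &&
    lyapAffLeafOKI n K (addDiagTab n s (conjDiagTab n d l.A0))
      (vtab K fun k ↦ conjDiagTab n d (l.As.getD k [])) (conjDiagTab n d l.R) r B l.inner

/-- **Per leaf**: positive scaling and an accepted leaf ⇒ every complex eigenvalue `μ` of `E(x)`,
`x` in the leaf box, has `Re μ ≤ −(s + r)` — the END-TO-END interval-`J` theorem of the affine file
applied to the one-leaf tree with the member `J′ := E(x)`.
[cite: GahinetApkarianChilali1996, §III; CarlsonSchneider1962, § 1; Moore1979, §4.4 eq. (4.19) (p. 43)] -/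
theorem re_le_neg_of_lyapRexLeafOK {n K : ℕ} {E : List (List RExpr)} {d : List ℚ} {s r : ℚ}
    {B : Box} {l : LyapRexLeaf} (hd : posListQ n d = true)
    (h : lyapRexLeafOK n K E d s r B l = true) (x : ℕ → ℝ) (hx : B.mem x) {μ : ℂ}
    (hμ : μ ∈ spectrum ℂ ((rexprMatrix n E x).map (algebraMap ℝ ℂ))) :
    μ.re ≤ -((s + r : ℚ) : ℝ) := by
  unfold lyapRexLeafOK at h
  rw [Bool.and_eq_true] at h
  exact re_le_neg_of_kdCheck_lyapAffI_conj_shifted (t := KdCert.leaf l.inner) hd h.2 x hx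
    (rexprAffOK_sound h.1 x hx) hμ

/-- **`RExpr` piecewise-affine Lyapunov certificate, box level (END-TO-END).** If the scaling `d` is
positive and the kd-tree checks with `lyapRexLeafOK n K E d s r` on `B`, then for every `x` of `B`
every complex eigenvalue `μ` of the real matrix `E(x)` satisfies `Re μ ≤ −(s + r)`.
[cite: GahinetApkarianChilali1996, §III; CarlsonSchneider1962, § 1; Moore1979, §4.4 eq. (4.19) (p. 43)] -/
theorem re_le_neg_of_kdCheck_lyapRex {n K : ℕ} {E : List (List RExpr)} {d : List ℚ} {s r : ℚ}
    {B : Box} {t : KdCert LyapRexLeaf} (hd : posListQ n d = true)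
    (h : t.check (lyapRexLeafOK n K E d s r) B = true) (x : ℕ → ℝ) (hx : B.mem x) {μ : ℂ}
    (hμ : μ ∈ spectrum ℂ ((rexprMatrix n E x).map (algebraMap ℝ ℂ))) :
    μ.re ≤ -((s + r : ℚ) : ℝ) :=
  KdCert.sound (P := fun x ↦ ∀ μ : ℂ, μ ∈ spectrum ℂ ((rexprMatrix n E x).map (algebraMap ℝ ℂ)) →
      μ.re ≤ -((s + r : ℚ) : ℝ))
    (fun _ _ hl x hx _ hμ ↦ re_le_neg_of_lyapRexLeafOK hd hl x hx hμ) t B h x hx μ hμ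

/-- **Hurwitz on the whole box** when `0 < s + r`. [cite: CarlsonSchneider1962, § 1] -/
theorem re_neg_of_kdCheck_lyapRex {n K : ℕ} {E : List (List RExpr)} {d : List ℚ} {s r : ℚ}
    {B : Box} {t : KdCert LyapRexLeaf} (hd : posListQ n d = true)
    (h : t.check (lyapRexLeafOK n K E d s r) B = true) (hsr : 0 < s + r) (x : ℕ → ℝ) (hx : B.mem x)
    {μ : ℂ} (hμ : μ ∈ spectrum ℂ ((rexprMatrix n E x).map (algebraMap ℝ ℂ))) : μ.re < 0 :=
  (re_le_neg_of_kdCheck_lyapRex hd h x hx hμ).trans_lt (by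
    have : (0 : ℝ) < ((s + r : ℚ) : ℝ) := by exact_mod_cast hsr
    linarith)

/-! ### Kernel example -/

/-- `E(x) = [[−1/x]]` on the box `x ∈ [1, 2]` (eigenvalue `−1/x ≤ −1/2`): ONE leaf with the first-order
model `−5461/4096 + (455/1024)·x` (≈ `−1/c + (x − c)/c²`, `c = 3/2`) and remainder radius
`2331307/8388608 ≈ 0.278 ≥ dev([−1/x](3/2), ·) + ½ · dev([x⁻²]([1, 2]) = [¼, 1], 455/1024)` at
enclosure precision `2⁻²⁴`; `P_c = 3/4`, `P^{(0)} = 1/2`, `π = 4097/4096`; certified rate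
`1363/8194 ≈ 0.166` (the model radius costs: the true decay is `½`). Produced by the certnum
`param.py` twin of `affRemQ`; the kernel re-derives the symbolic derivative and both enclosures itself. -/
example : KdCert.check (lyapRexLeafOK 1 1 [[(.neg (.inv (.var 0)))]] [1] 0 (1363/8194)) [(1, 2)]
    (.leaf ⟨[[(-5461/4096)]], [[[(455/1024)]]], [[(2331307/8388608)]], (24, 0),
      ⟨[[(3/4)]], [[[(1/2)]]], (4097/4096),
        ⟨(2047/4096), [⟨(2047/4096), 1, [[1]], [0]⟩, ⟨(4095/4096), 1, [[1]], [0]⟩]⟩,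
        ⟨(-4097/4096), [⟨(-2049/4096), 1, [[1]], [0]⟩, ⟨(-4097/4096), 1, [[1]], [0]⟩]⟩,
        ⟨(1363/4096), [⟨(1363/4096), 1, [[1]], [0]⟩, ⟨(341/1024), 1, [[1]], [0]⟩]⟩⟩⟩) = true := by
  decide +kernel

end Literature.Analysis.ValidatedNumerics
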